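import Literature.NumberTheory.EllipticCurves.BinaryQuarticDiscriminantStrata
import Literature.NumberTheory.EllipticCurves.BinaryQuarticCovariants
import Mathlib.FieldTheory.IsAlgClosed.AlgebraicClosure
import HarnessLib

/-!
# Binary quartic forms with vanishing discriminant over a field with `6 ≠ 0`: triple root,
# square of a quadratic, or a single *rational* double root

`Proofs` companion (theorems only: no definitions, no named facts) of `BinaryQuarticForms.lean`
and `BinaryQuarticDiscriminantStrata.lean` (`BinaryQuartic.ofRoots`, `exists_eq_ofRoots`,
`disc_ofRoots`, `I_ofRoots_triple`, `J_ofRoots_triple`).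

Source and role. M. Bhargava, A. Shankar, *Binary quartic forms having bounded invariants, and the
boundedness of the average rank of elliptic curves*, Ann. of Math. (2) 181 (2015) 191–242, proof
of Prop. 5.13 of the held arXiv text `arXiv:1006.1002v2` (= Prop. 3.18 of the published version):
a form `f ∈ V_{ℤ_p}` that is not `ℚ_p`-soluble has `p² ∣ Δ(f)`; the argument sorts the reductions
`f mod p` with `Δ ≡ 0` by splitting type — "(1²11) or (1²2)": a single double root, which is then
`𝔽_p`-rational and lets `f` be shown soluble by Hensel's lemma; versus the deeper types `(1³1)`,
`(1⁴)`, `(1²1²)`, `(2²)`, which force `p² ∣ Δ` (`BinaryQuarticDiscriminantFirstOrderProofs`).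
This file proves the underlying **structure theorem over an arbitrary field `F` with `2 ≠ 0`,
`3 ≠ 0`** (applied to `F = 𝔽_p`, `p ≥ 5`): for `f ∈ V_F` with `a ≠ 0` and `Δ(f) = 0`, exactly as
in the classical description of the discriminant locus, one of

1. `I(f) = J(f) = 0` (a root of multiplicity `≥ 3`);
2. `f = λ · q²` for a quadratic form `q = x² + q₁xy + q₂y²` **with coefficients in `F`**;
3. `f = (x − ry)² · k` with `r ∈ F` **rational**, `k = k₀x² + k₁xy + k₂y²` over `F`,
   `k(r, 1) ≠ 0` and `disc(k) ≠ 0` (splitting type `(1²11)` or `(1²2)`)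

holds (`BinaryQuartic.doubleRoot_structure`). The proof factors `f` over an algebraic closure
(`exists_eq_ofRoots`), reads off the coincidences among the roots from `Δ = a⁶∏(rᵢ − rⱼ)² = 0`,
and descends: in case 2 the coefficients of `q` are `b/2a` and `(c/a − (b/2a)²)/2`; in case 3 the
double root is recovered *rationally* from the quartic covariant, through the identity
`2I·g₄(f) + 4J·f = 6a⁴(r−s)²(r−t)²(s−t)² · (x − ry)⁴` for `f = a(x−ry)²(x−sy)(x−ty)`
(`ofRoots_double_Q_a`, `ofRoots_double_Q_b`), so that `r = −Q_b/(4Q_a)` with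
`Q = 2I·g₄ + 4J·f ∈ V_F`.

## References

* M. Bhargava, A. Shankar, Ann. of Math. (2) 181 (2015), proof of Prop. 5.13 (arXiv:1006.1002v2
  numbering) = Prop. 3.18 (published): the splitting types `(1²11)`, `(1²2)`.
  [cite: BhargavaShankarAnnals2015, Prop. 5.13, proof (arXiv:1006.1002v2 numbering)]
* J. E. Cremona, *Classical invariants and 2-descent on elliptic curves*, J. Symbolic Comput. 31
  (2001), §2–3 (the covariant `g₄`, the resolvent). [cite: Cremona2001, §2]
-/

noncomputable section

open scoped Classical

namespace Literature.NumberTheory.EllipticCurves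

namespace BinaryQuartic

section CommRing

variable {R : Type*} [CommRing R]

/-! ## Identities for a form `a(x − ry)²(x − sy)(x − ty)` with a double root -/

/-- For `f = a(x−ry)²(x−sy)(x−ty)`: `f = (x − ry)²·k` with `k = a(x−sy)(x−ty)`, whose middle
coefficient is `b + 2ra = −a(s+t)`. [folklore] -/
theorem ofRoots_double_k₁ (a r s t : R) :
    (ofRoots a r r s t).b + 2 * r * (ofRoots a r r s t).a = -(a * (s + t)) := by
  simp only [ofRoots]; ring

/-- For `f = a(x−ry)²(x−sy)(x−ty)`: the last coefficient of `k` is `c + 2rb + 3r²a = ast`.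
[folklore] -/
theorem ofRoots_double_k₂ (a r s t : R) :
    (ofRoots a r r s t).c + 2 * r * (ofRoots a r r s t).b + 3 * r ^ 2 * (ofRoots a r r s t).a
      = a * s * t := by
  simp only [ofRoots]; ring

/-- For `f = a(x−ry)²(x−sy)(x−ty)`: `d = −2r·k₂ + r²·k₁`. [folklore] -/
theorem ofRoots_double_d (a r s t : R) :
    (ofRoots a r r s t).d = -2 * r * (a * s * t) + r ^ 2 * (-(a * (s + t))) := by
  simp only [ofRoots]; ring

/-- For `f = a(x−ry)²(x−sy)(x−ty)`: `e = r²·k₂`. [folklore] -/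
theorem ofRoots_double_e (a r s t : R) :
    (ofRoots a r r s t).e = r ^ 2 * (a * s * t) := by
  simp only [ofRoots]; ring

/-- For `f = a(x−ry)²(x−sy)(x−ty)`: `k(r, 1) = a(r−s)(r−t)`. [folklore] -/
theorem ofRoots_double_k_eval (a r s t : R) :
    a * r ^ 2 + (-(a * (s + t))) * r + a * s * t = a * (r - s) * (r - t) := by
  ring

/-- For `f = a(x−ry)²(x−sy)(x−ty)`: `disc(k) = a²(s−t)²`. [folklore] -/
theorem ofRoots_double_k_disc (a s t : R) :
    (-(a * (s + t))) ^ 2 - 4 * a * (a * s * t) = a ^ 2 * (s - t) ^ 2 := by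
  ring

/-- **The quartic covariant at a form with a double root:** for `f = a(x−ry)²(x−sy)(x−ty)` the form
`Q = 2I(f)·g₄(f) + 4J(f)·f` is `6a⁴(r−s)²(r−t)²(s−t)²·(x − ry)⁴`; its leading coefficient.
[cite: Cremona2001, §2 (g₄)] -/
theorem ofRoots_double_Q_a {K : Type*} [Field K] (a r s t : K) :
    ((2 * (ofRoots a r r s t).I) • g4 (ofRoots a r r s t)
      + (4 * (ofRoots a r r s t).J) • ofRoots a r r s t).a
      = 6 * a ^ 4 * ((r - s) * (r - t)) ^ 2 * (s - t) ^ 2 := by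
  simp only [add_a, smul_a, g4, I, J, ofRoots]; ring

/-- The second coefficient of `Q = 2I·g₄ + 4J·f` at `f = a(x−ry)²(x−sy)(x−ty)` is `−4r` times the
first: `Q ∝ (x − ry)⁴`. [cite: Cremona2001, §2 (g₄)] -/
theorem ofRoots_double_Q_b {K : Type*} [Field K] (a r s t : K) :
    ((2 * (ofRoots a r r s t).I) • g4 (ofRoots a r r s t)
      + (4 * (ofRoots a r r s t).J) • ofRoots a r r s t).b
      = -4 * r * (6 * a ^ 4 * ((r - s) * (r - t)) ^ 2 * (s - t) ^ 2) := by
  simp only [add_b, smul_b, g4, I, J, ofRoots]; ring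

/-- **The square stratum:** `a(x−ry)²(x−sy)² = a·q²` with `q = x² − (r+s)xy + rs·y²`. [folklore] -/
theorem ofRoots_pair_eq_smul_sq (a r s : R) :
    ofRoots a r r s s = a • (⟨1 ^ 2, 2 * 1 * (-(r + s)), (-(r + s)) ^ 2 + 2 * 1 * (r * s),
      2 * (-(r + s)) * (r * s), (r * s) ^ 2⟩ : BinaryQuartic R) := by
  ext <;> simp only [ofRoots, smul_a, smul_b, smul_c, smul_d, smul_e] <;> ring

/-- If `Δ(a∏(x − rᵢy)) = 0` with `a ≠ 0` over a domain, two of the roots coincide; after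
reordering, `f = a(x−ry)²(x−sy)(x−ty)`. [folklore] -/
theorem exists_ofRoots_double_of_disc_eq_zero [IsDomain R] {a r₁ r₂ r₃ r₄ : R} (ha : a ≠ 0)
    (h : (ofRoots a r₁ r₂ r₃ r₄).disc = 0) :
    ∃ r s t : R, ofRoots a r₁ r₂ r₃ r₄ = ofRoots a r r s t := by
  rw [disc_ofRoots] at h
  have h' := (mul_eq_zero.mp h).resolve_left (pow_ne_zero _ ha)
  rw [sq_eq_zero_iff] at h'
  simp only [mul_eq_zero, sub_eq_zero] at h'
  rcases h' with ((((h12 | h13) | h14) | h23) | h24) | h34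
  · exact ⟨r₁, r₃, r₄, by rw [h12]⟩
  · exact ⟨r₁, r₂, r₄, by rw [h13, ofRoots_swap₂₃]⟩
  · exact ⟨r₁, r₂, r₃, by rw [h14, ofRoots_swap₃₄, ofRoots_swap₂₃]⟩
  · exact ⟨r₂, r₁, r₄, by rw [h23, ofRoots_swap₁₂, ofRoots_swap₂₃]⟩
  · exact ⟨r₂, r₁, r₃, by rw [h24, ofRoots_swap₃₄, ofRoots_swap₁₂, ofRoots_swap₂₃]⟩
  · exact ⟨r₃, r₁, r₂, by rw [h34, ofRoots_swap₂₃, ofRoots_swap₃₄, ofRoots_swap₁₂, ofRoots_swap₂₃]⟩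

/-- Change of ring commutes with scaling of forms. [folklore] -/
theorem map_smul_form {S : Type*} [CommRing S] (φ : R →+* S) (μ : R) (f : BinaryQuartic R) :
    (μ • f).map φ = φ μ • f.map φ := by
  ext <;> simp [map]

/-- Change of ring commutes with addition of forms. [folklore] -/
theorem map_add_form {S : Type*} [CommRing S] (φ : R →+* S) (f g : BinaryQuartic R) :
    (f + g).map φ = f.map φ + g.map φ := by
  ext <;> simp [map]

/-- An injective change of ring is injective on forms. [folklore] -/
theorem map_injective_of_injective {S : Type*} [CommRing S] {φ : R →+* S}
    (hφ : Function.Injective φ) {f g : BinaryQuartic R} (h : f.map φ = g.map φ) : f = g := by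
  have ha := congrArg BinaryQuartic.a h
  have hb := congrArg BinaryQuartic.b h
  have hc := congrArg BinaryQuartic.c h
  have hd := congrArg BinaryQuartic.d h
  have he := congrArg BinaryQuartic.e h
  simp only [map_a, map_b, map_c, map_d, map_e] at ha hb hc hd he
  ext
  exacts [hφ ha, hφ hb, hφ hc, hφ hd, hφ he]

end CommRing

/-! ## The structure theorem -/

section Field

variable {F : Type*} [Field F]

/-- **Forms with `Δ = 0` over a field with `2 ≠ 0`, `3 ≠ 0` (leading coefficient `a ≠ 0`):
triple root, or square of a rational quadratic, or a single rational double root with cofactor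
`k` having `k(r,1) ≠ 0` and `disc(k) ≠ 0`** (splitting type `(1²11)`/`(1²2)`), as used in the
proof of Bhargava–Shankar's Prop. 5.13 / Prop. 3.18. [cite: BhargavaShankarAnnals2015, Prop. 5.13, proof (arXiv:1006.1002v2 numbering)] -/
theorem doubleRoot_structure (h2 : (2 : F) ≠ 0) (h3 : (3 : F) ≠ 0) {f : BinaryQuartic F}
    (ha : f.a ≠ 0) (hΔ : f.disc = 0) :
    (f.I = 0 ∧ f.J = 0) ∨
    (∃ lam q₁ q₂ : F, f = lam • (⟨1 ^ 2, 2 * 1 * q₁, q₁ ^ 2 + 2 * 1 * q₂, 2 * q₁ * q₂, q₂ ^ 2⟩ :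
      BinaryQuartic F)) ∨
    (∃ r k₀ k₁ k₂ : F, f.a = k₀ ∧ f.b = k₁ - 2 * r * k₀ ∧ f.c = k₂ - 2 * r * k₁ + r ^ 2 * k₀ ∧
      f.d = -2 * r * k₂ + r ^ 2 * k₁ ∧ f.e = r ^ 2 * k₂ ∧ k₀ * r ^ 2 + k₁ * r + k₂ ≠ 0 ∧
      k₁ ^ 2 - 4 * k₀ * k₂ ≠ 0) := by
  -- factor over an algebraic closure
  set K := AlgebraicClosure F with hK
  set ι : F →+* K := algebraMap F K with hι
  have hinj : Function.Injective ι := (algebraMap F K).injective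
  set fK := f.map ι with hfK
  have haK : fK.a ≠ 0 := by rw [hfK, map_a]; exact (map_ne_zero ι).mpr ha
  obtain ⟨a, r₁, r₂, r₃, r₄, haa, hroots⟩ := exists_eq_ofRoots fK haK
  have hΔK : (ofRoots a r₁ r₂ r₃ r₄).disc = 0 := by rw [← hroots, hfK, disc_map, hΔ, map_zero]
  obtain ⟨r, s, t, hrst⟩ := exists_ofRoots_double_of_disc_eq_zero haa hΔK
  rw [hrst] at hroots
  -- `hroots : fK = ofRoots a r r s t`
  have h2K : (2 : K) ≠ 0 := by rw [← map_ofNat ι 2]; exact (map_ne_zero ι).mpr h2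
  have h3K : (3 : K) ≠ 0 := by rw [← map_ofNat ι 3]; exact (map_ne_zero ι).mpr h3
  have haι : ι f.a = a := by
    have := congrArg BinaryQuartic.a hroots
    rwa [hfK, map_a, ofRoots_a] at this
  -- triple root: `I = J = 0`
  have triple : ∀ r' t' : K, fK = ofRoots a r' r' r' t' → f.I = 0 ∧ f.J = 0 := by
    intro r' t' h
    constructor
    · apply hinj
      rw [map_zero, ← I_map, ← hfK, h, I_ofRoots_triple]
    · apply hinj
      rw [map_zero, ← J_map, ← hfK, h, J_ofRoots_triple]
  by_cases hsr : s = r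
  · exact Or.inl (triple r t (by rw [hroots, hsr]))
  by_cases htr : t = r
  · exact Or.inl (triple r s (by rw [hroots, htr, ofRoots_swap₃₄]))
  by_cases hst : s = t
  · -- square of a rational quadratic
    right; left
    have hbι : ι f.b = -(2 * a * (r + s)) := by
      have := congrArg BinaryQuartic.b hroots
      rw [hfK, map_b, hst] at this
      rw [this, hst]; simp only [ofRoots]; ring
    have hcι : ι f.c = a * ((r + s) ^ 2 + 2 * (r * s)) := by
      have := congrArg BinaryQuartic.c hroots
      rw [hfK, map_c, hst] at this
      rw [this, hst]; simp only [ofRoots]; ring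
    set q₁ := f.b / (2 * f.a) with hq₁
    set q₂ := (f.c / f.a - q₁ ^ 2) / 2 with hq₂
    have hq₁ι : ι q₁ = -(r + s) := by
      rw [hq₁, map_div₀, map_mul, haι, hbι, map_ofNat, div_eq_iff (mul_ne_zero h2K haa)]
      ring
    have hq₂ι : ι q₂ = r * s := by
      rw [hq₂, map_div₀, map_sub, map_div₀, map_pow, hq₁ι, hcι, haι, map_ofNat,
        div_eq_iff h2K, mul_div_cancel_left₀ _ haa]
      ring
    refine ⟨f.a, q₁, q₂, map_injective_of_injective hinj ?_⟩
    rw [map_smul_form, ← hfK, hroots, hst, ofRoots_pair_eq_smul_sq, haι]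
    congr 1
    ext <;> simp only [map, map_pow, map_mul, map_add, map_ofNat, map_one, hq₁ι, hq₂ι, hst]
  · -- a single double root, recovered rationally from the quartic covariant
    right; right
    set Q := (2 * f.I) • g4 f + (4 * f.J) • f with hQ
    have hQmap : Q.map ι = (2 * fK.I) • g4 fK + (4 * fK.J) • fK := by
      rw [hQ, map_add_form, map_smul_form, map_smul_form, hfK, g4_map, I_map, J_map]
      simp only [map_mul, map_ofNat]
    set κ := 6 * a ^ 4 * ((r - s) * (r - t)) ^ 2 * (s - t) ^ 2 with hκ
    have hκ0 : κ ≠ 0 := by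
      have h6 : (6 : K) ≠ 0 := by
        rw [show (6 : K) = 2 * 3 by norm_num]; exact mul_ne_zero h2K h3K
      refine mul_ne_zero (mul_ne_zero (mul_ne_zero h6 (pow_ne_zero _ haa)) (pow_ne_zero _
        (mul_ne_zero (sub_ne_zero.mpr (Ne.symm hsr)) (sub_ne_zero.mpr (Ne.symm htr)))))
        (pow_ne_zero _ (sub_ne_zero.mpr hst))
    have hQa : ι Q.a = κ := by
      rw [← map_a, hQmap, hroots, hκ]; exact ofRoots_double_Q_a a r s t
    have hQb : ι Q.b = -4 * r * κ := by
      rw [← map_b, hQmap, hroots, hκ]; exact ofRoots_double_Q_b a r s t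
    have hQa0 : Q.a ≠ 0 := fun h ↦ hκ0 (by rw [← hQa, h, map_zero])
    set r' := -Q.b / (4 * Q.a) with hr'
    have hr'ι : ι r' = r := by
      rw [hr', map_div₀, map_neg, map_mul, hQa, hQb, map_ofNat]
      have h4 : (4 : K) ≠ 0 := by
        rw [show (4 : K) = 2 * 2 by norm_num]; exact mul_ne_zero h2K h2K
      rw [div_eq_iff (mul_ne_zero h4 hκ0)]
      ring
    set k₀ := f.a with hk₀
    set k₁ := f.b + 2 * r' * f.a with hk₁
    set k₂ := f.c + 2 * r' * f.b + 3 * r' ^ 2 * f.a with hk₂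
    have hbι : ι f.b = (ofRoots a r r s t).b := by rw [← map_b, ← hfK, hroots]
    have hcι : ι f.c = (ofRoots a r r s t).c := by rw [← map_c, ← hfK, hroots]
    have hdι : ι f.d = (ofRoots a r r s t).d := by rw [← map_d, ← hfK, hroots]
    have heι : ι f.e = (ofRoots a r r s t).e := by rw [← map_e, ← hfK, hroots]
    have haι' : ι f.a = (ofRoots a r r s t).a := by rw [haι, ofRoots_a]
    have hk₁ι : ι k₁ = -(a * (s + t)) := by
      rw [hk₁, map_add, map_mul, map_mul, map_ofNat, hr'ι, hbι, haι', ofRoots_double_k₁]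
    have hk₂ι : ι k₂ = a * s * t := by
      rw [hk₂, map_add, map_add, map_mul, map_mul, map_mul, map_mul, map_pow, map_ofNat,
        map_ofNat, hr'ι, hbι, hcι, haι', ofRoots_double_k₂]
    refine ⟨r', k₀, k₁, k₂, rfl, by rw [hk₁, hk₀]; ring, by rw [hk₂, hk₁, hk₀]; ring, ?_, ?_, ?_, ?_⟩
    · apply hinj
      rw [hdι, map_add, map_mul, map_mul, map_mul, map_neg, map_pow, map_ofNat, hr'ι, hk₁ι, hk₂ι]
      exact ofRoots_double_d a r s t
    · apply hinj
      rw [heι, map_mul, map_pow, hr'ι, hk₂ι]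
      exact ofRoots_double_e a r s t
    · intro h
      have := congrArg ι h
      rw [map_add, map_add, map_mul, map_mul, map_pow, hr'ι, hk₁ι, hk₂ι, haι, map_zero,
        ofRoots_double_k_eval] at this
      exact mul_ne_zero (mul_ne_zero haa (sub_ne_zero.mpr (Ne.symm hsr)))
        (sub_ne_zero.mpr (Ne.symm htr)) this
    · intro h
      have := congrArg ι h
      rw [map_sub, map_pow, map_mul, map_mul, map_ofNat, hk₁ι, hk₂ι, haι, map_zero,
        ofRoots_double_k_disc] at this
      exact mul_ne_zero (pow_ne_zero _ haa) (pow_ne_zero _ (sub_ne_zero.mpr hst)) this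

/-- The cofactor identities of case 3 say `f(x, y) = (x − ry)²·(k₀x² + k₁xy + k₂y²)`. [folklore] -/
theorem eval_eq_of_doubleRoot {f : BinaryQuartic F} {r k₀ k₁ k₂ : F} (ha : f.a = k₀)
    (hb : f.b = k₁ - 2 * r * k₀) (hc : f.c = k₂ - 2 * r * k₁ + r ^ 2 * k₀)
    (hd : f.d = -2 * r * k₂ + r ^ 2 * k₁) (he : f.e = r ^ 2 * k₂) (x y : F) :
    f.eval x y = (x - r * y) ^ 2 * (k₀ * x ^ 2 + k₁ * x * y + k₂ * y ^ 2) := by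
  simp only [eval, ha, hb, hc, hd, he]; ring

end Field

end BinaryQuartic

end Literature.NumberTheory.EllipticCurves

end
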